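import Summits.AtomisticToContinuum.Crystallization.Theorems.ChartedZeroExcessLayeredLatticeLiouvilleTX
import Literature.Analysis.PDE.GeometricRigidityLp

/-!
# Zero-excess layered lattice Liouville — part TY (lens-2 g42/g43): K_F from geometric rigidity in `L³`

`fieldRigidityP_of_geometricRigidityLp : FrieseckeJamesMuller2002_geometricRigidityLp → aHi ≤ 8/7 → FieldRigidityP aHi`.

The (K)-side open piece `FieldRigidityP aHi` of the LINE column `_16XH19(_tol)` (part TV) follows from the NAMED Literature fact
`Literature.Analysis.PDE.FrieseckeJamesMuller2002_geometricRigidityLp` (geometric rigidity in `L^p`, Lipschitz maps on balls; used at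
`n = 3`, `p = 3`) applied to the partition-of-unity interpolant `u = interp W Ψ Q` of part TX on the ball `B₀ = ball 0 (R − 9/10)`:

* COVERING (TW): every `y ∈ B₀` has a window site within `9/10`, so the weight is `≥ 1`, `u` is differentiable at `y` with derivative
  `interpDeriv W Ψ Q x₀ y` for any base `x₀`, `‖∇u(y)‖ ≤ 1 + C₁·Σ_W σ` (TX), hence `u` is Lipschitz on the convex set `B₀`;
* POINTWISE (TX ★★ + TW local Hölder): `dist(∇u(y), SO(3))³ ≤ ‖∇u(y) − Q x(y)‖³ ≤ C₁³·N₂²·g(y)`, `g(y) = Σ_{x ∈ W, dist x y ≤ 5/2} σ x³`,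
  and `∫_{B₀} g ≤ |B(5/2)| · Σ_W σ³`;
* THE FACT gives `Rot ∈ SO(3)` with `∫_{B₀} ‖∇u − Rot‖³ ≤ C_L ∫_{B₀} dist(∇u, SO(3))³`;
* READ-BACK on the pairwise-disjoint balls `B(κ•x₀, r₀) ⊆ B₀` (`κ = 1 − (21/20)/R`, `r₀ = min(δ/4, 1/8)`, all `x₀ ∈ W`, `R ≥ 3`), on which
  `dist y x₀ ≤ 47/40`: `|B(r₀)|·‖Q x₀ − Rot‖³ ≤ 4 ∫_{B(κx₀,r₀)} (C₁³N₂² g + ‖∇u − Rot‖³)`; summing, `Σ_W ‖Q x₀ − Rot‖³ ≤ C_F · Σ_W σ³` with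
  `C_F = 4·C₁³·N₂²·|B(5/2)|·(1 + C_L)/|B(r₀)|` — a constant depending on `δ` only (through `C₁`, `N₂`, `r₀`), as (K_F) demands.

No `sorry`, no new axioms, no type-class declarations, no custom syntax, no option pragmas.  ENERGY-FREE, θ-FREE, chart-free.
-/

noncomputable section

open scoped BigOperators RealInnerProductSpace NNReal
open MeasureTheory Set Metric Filter Topology
open Summit.AtomisticToContinuum.Crystallization.Theorems.ChartedPlanarOrderRigidityDoor (E3 atomsIn)
open Summit.AtomisticToContinuum.Crystallization.Theorems.ChartedPlanarOrderDensityDichotomy (μS IsSep nK nK_nonneg)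
open Summit.AtomisticToContinuum.Crystallization.Theorems.ChartedPlanarOrderCleanScaleP (IsCleanP IsDoorSetP isCleanP_μS_iff)
open Literature.Geometry.DiscreteGeometry (IsTwoShellGoodSet)
open Literature.Analysis.PDE (rotations FrieseckeJamesMuller2002_geometricRigidityLp)

namespace Summit.AtomisticToContinuum.Crystallization.Theorems.ChartedZeroExcessLayeredLatticeLiouville

/-! ### XXV.1 The cubic majorant and its integral -/

section Majorant

/-- `g(y) = Σ_{x ∈ W} 1[y ∈ closedBall x (5/2)] · σ x³`. -/
def gmaj (W : Finset E3) (σ : E3 → ℝ) (y : E3) : ℝ := ∑ x ∈ W, (closedBall x (5 / 2)).indicator (fun _ => σ x ^ 3) y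

variable {W : Finset E3} {σ : E3 → ℝ}

/-- the majorant as a sum over the window sites within `5/2`. [this file] -/
theorem gmaj_eq_sum_filter (y : E3) : gmaj W σ y = ∑ x ∈ W.filter (fun x => dist x y ≤ 5 / 2), σ x ^ 3 := by
  unfold gmaj
  rw [Finset.sum_filter]
  refine Finset.sum_congr rfl fun x _ => ?_
  by_cases h : dist x y ≤ 5 / 2
  · rw [if_pos h, Set.indicator_of_mem (by rw [mem_closedBall, dist_comm]; exact h)]
  · rw [if_neg h, Set.indicator_of_notMem (by rw [mem_closedBall, dist_comm]; exact h)]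

/-- the majorant is measurable. [this file] -/
theorem measurable_gmaj : Measurable (gmaj W σ) :=
  Finset.measurable_sum _ fun _ _ => measurable_const.indicator measurableSet_closedBall

/-- the majorant is nonnegative. [this file] -/
theorem gmaj_nonneg (hσ : ∀ x, 0 ≤ σ x) (y : E3) : 0 ≤ gmaj W σ y :=
  Finset.sum_nonneg fun x _ => Set.indicator_nonneg (fun _ _ => pow_nonneg (hσ x) 3) _

/-- the majorant is bounded by the full window sum `Σ_W σ³`. [this file] -/
theorem gmaj_le_sum (hσ : ∀ x, 0 ≤ σ x) (y : E3) : gmaj W σ y ≤ ∑ x ∈ W, σ x ^ 3 :=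
  Finset.sum_le_sum fun x _ => Set.indicator_le_self' (fun _ _ => pow_nonneg (hσ x) 3) _

/-- the majorant is integrable (finite sum of integrable indicators). [this file] -/
theorem integrable_gmaj : Integrable (gmaj W σ) := by
  refine integrable_finsetSum _ fun x _ => ?_
  exact (integrable_indicator_iff measurableSet_closedBall).2 (integrableOn_const (measure_closedBall_lt_top).ne)

/-- `∫_s g ≤ |B(5/2)| · Σ_W σ³` on every set `s`. -/
theorem setIntegral_gmaj_le (hσ : ∀ x, 0 ≤ σ x) (s : Set E3) :
    ∫ y in s, gmaj W σ y ≤ (volume (closedBall (0 : E3) (5 / 2))).toReal * ∑ x ∈ W, σ x ^ 3 := by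
  have hint : ∀ x ∈ W, Integrable (fun y => (closedBall x (5 / 2)).indicator (fun _ => σ x ^ 3) y) (volume.restrict s) := fun x _ =>
    ((integrable_indicator_iff measurableSet_closedBall).2 (integrableOn_const (measure_closedBall_lt_top).ne)).restrict
  unfold gmaj
  rw [integral_finsetSum _ hint, Finset.mul_sum]
  refine Finset.sum_le_sum fun x _ => ?_
  rw [integral_indicator measurableSet_closedBall, setIntegral_const, smul_eq_mul, measureReal_def, Measure.restrict_apply measurableSet_closedBall]
  have hfin : volume (closedBall x (5 / 2)) ≠ ⊤ := (measure_closedBall_lt_top).ne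
  have hmono : (volume (closedBall x (5 / 2) ∩ s)).toReal ≤ (volume (closedBall (0 : E3) (5 / 2))).toReal := by
    rw [← Measure.addHaar_closedBall_center volume x]
    exact ENNReal.toReal_mono hfin (measure_mono Set.inter_subset_left)
  exact mul_le_mul_of_nonneg_right hmono (pow_nonneg (hσ x) 3)

end Majorant

/-! ### XXV.2 Elementary inequalities and the read-back geometry -/

section Geometry

/-- `(a+b)³ ≤ 4(a³+b³)` for `a, b ≥ 0`. [folklore] -/
private theorem add_pow_three_le_four (a b : ℝ) (ha : 0 ≤ a) (hb : 0 ≤ b) : (a + b) ^ 3 ≤ 4 * (a ^ 3 + b ^ 3) := by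
  nlinarith [sq_nonneg (a - b), mul_nonneg ha hb, sq_nonneg (a + b)]

variable {δ R : ℝ}

/-- the homothety factor `κ = 1 − (21/20)/R`. -/
def kap (R : ℝ) : ℝ := 1 - 21 / 20 / R

/-- `13/20 ≤ kap R ≤ 1` for `R ≥ 3`. [this file] -/
theorem kap_bounds (hR : 3 ≤ R) : 13 / 20 ≤ kap R ∧ kap R ≤ 1 := by
  unfold kap
  have hR0 : 0 < R := by linarith
  constructor
  · have : 21 / 20 / R ≤ 21 / 20 / 3 := div_le_div_of_nonneg_left (by norm_num) (by norm_num) hR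
    linarith
  · have : 0 ≤ 21 / 20 / R := by positivity
    linarith

/-- the read-back radius `r₀ = min(δ/4, 1/8)`. -/
def rrb (δ : ℝ) : ℝ := min (δ / 4) (1 / 8)

/-- the read-back radius is positive. [this file] -/
theorem rrb_pos (hδ : 0 < δ) : 0 < rrb δ := lt_min (by linarith) (by norm_num)

/-- the read-back radius is at most `1/8`. [this file] -/
theorem rrb_le_eighth (δ : ℝ) : rrb δ ≤ 1 / 8 := min_le_right _ _

/-- the read-back radius is at most `δ/4`. [this file] -/
theorem rrb_le_quarter (δ : ℝ) : rrb δ ≤ δ / 4 := min_le_left _ _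

/-- a read-back ball lies in `B₀`, and its points are within `6/5` of the base site. -/
theorem readBack_mem (hR : 3 ≤ R) {x₀ y : E3} (hx₀ : ‖x₀‖ ≤ R) (hy : y ∈ ball (kap R • x₀) (rrb δ)) :
    ‖y‖ < R - 9 / 10 ∧ dist y x₀ ≤ 6 / 5 := by
  obtain ⟨hk1, hk2⟩ := kap_bounds hR
  have hk0 : 0 ≤ kap R := by linarith
  have hR0 : 0 < R := by linarith
  have hy' : dist y (kap R • x₀) < rrb δ := mem_ball.1 hy
  have hr8 := rrb_le_eighth δ
  have hnk : ‖kap R • x₀‖ = kap R * ‖x₀‖ := by rw [norm_smul, Real.norm_eq_abs, abs_of_nonneg hk0]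
  have hkx : ‖kap R • x₀ - x₀‖ = (1 - kap R) * ‖x₀‖ := by
    rw [show kap R • x₀ - x₀ = -((1 - kap R) • x₀) by rw [sub_smul, one_smul]; abel, norm_neg, norm_smul, Real.norm_eq_abs,
      abs_of_nonneg (by linarith)]
  have h1k : (1 - kap R) * ‖x₀‖ ≤ 21 / 20 := by
    have h1 : (1 - kap R) * ‖x₀‖ ≤ (1 - kap R) * R := mul_le_mul_of_nonneg_left hx₀ (by linarith)
    have h2 : (1 - kap R) * R = 21 / 20 := by unfold kap; field_simp; ring
    linarith
  constructor
  · calc ‖y‖ ≤ ‖y - kap R • x₀‖ + ‖kap R • x₀‖ := norm_le_norm_sub_add y _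
      _ < rrb δ + kap R * ‖x₀‖ := by rw [← dist_eq_norm, hnk]; linarith
      _ ≤ 1 / 8 + kap R * R := by nlinarith
      _ = R - 21 / 20 + 1 / 8 := by unfold kap; field_simp; ring
      _ < R - 9 / 10 := by linarith
  · calc dist y x₀ ≤ dist y (kap R • x₀) + dist (kap R • x₀) x₀ := dist_triangle _ _ _
      _ ≤ rrb δ + (1 - kap R) * ‖x₀‖ := by rw [dist_eq_norm (kap R • x₀), hkx]; linarith
      _ ≤ 6 / 5 := by linarith

/-- distinct `δ`-separated sites have disjoint read-back balls. -/
theorem readBack_disjoint (hδ : 0 < δ) (hR : 3 ≤ R) {x₀ x₁ : E3} (hsep : δ ≤ dist x₀ x₁) :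
    Disjoint (ball (kap R • x₀) (rrb δ)) (ball (kap R • x₁) (rrb δ)) := by
  obtain ⟨hk1, hk2⟩ := kap_bounds hR
  have hk0 : 0 ≤ kap R := by linarith
  have hcent : dist (kap R • x₀) (kap R • x₁) = kap R * dist x₀ x₁ := by
    rw [dist_eq_norm, dist_eq_norm, ← smul_sub, norm_smul, Real.norm_eq_abs, abs_of_nonneg hk0]
  have hr4 := rrb_le_quarter δ
  refine Set.disjoint_left.2 fun y hy0 hy1 => ?_
  have h0 : dist y (kap R • x₀) < rrb δ := mem_ball.1 hy0
  have h1 : dist y (kap R • x₁) < rrb δ := mem_ball.1 hy1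
  have htri : dist (kap R • x₀) (kap R • x₁) ≤ dist y (kap R • x₀) + dist y (kap R • x₁) := by
    rw [dist_comm y (kap R • x₀)]; exact dist_triangle _ _ _
  nlinarith

/-- all read-back balls have the volume of `B(0, rrb δ)`. [this file] -/
theorem volume_readBack (x₀ : E3) (R δ : ℝ) : volume (ball (kap R • x₀) (rrb δ)) = volume (ball (0 : E3) (rrb δ)) :=
  Measure.addHaar_ball_center volume _ _

end Geometry

/-! ### XXV.3 The theorem -/

section Main

variable {aHi δ : ℝ} {S : Set E3} {R : ℝ} {Ψ : E3 → E3} {Q : E3 → (E3 ≃ₗᵢ[ℝ] E3)} {σ : E3 → ℝ}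

/-- `Q x` (as a continuous linear map) is a proper rotation, for tilt–strain data. -/
theorem rotL_mem_rotations (hd : IsTiltStrainData S R Ψ Q σ) (x : E3) : rotL Q x ∈ rotations 3 := by
  refine ⟨fun v => by simp [rotL], ?_⟩
  have h := hd.1 x
  have hcoe : ((rotL Q x : E3 →L[ℝ] E3) : E3 →ₗ[ℝ] E3) = ((Q x).toLinearEquiv : E3 →ₗ[ℝ] E3) := LinearMap.ext fun v => rfl
  rw [hcoe]; exact h

/-- ★★★ **K_F from geometric rigidity in `L³`.**  For `aHi ≤ 8/7`, the named fact `FrieseckeJamesMuller2002_geometricRigidityLp`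
implies `FieldRigidityP aHi` — with `R_F = 3` and `C_F(δ) = 4·C₁(δ,M)³·N₂(δ)²·|B(5/2)|·(1 + C_L(3,3))/|B(min(δ/4,1/8))|`. -/
theorem fieldRigidityP_of_geometricRigidityLp (hfact : FrieseckeJamesMuller2002_geometricRigidityLp) (haHi : aHi ≤ 8 / 7) :
    FieldRigidityP aHi := by
  intro δ hδ
  obtain ⟨M, hM0, hM⟩ := exists_bound_fderiv_φ₀
  obtain ⟨CL, hCL0, hCL⟩ := hfact 3 (by norm_num) 3 (by norm_num)
  -- constants
  set C₁ : ℝ := Cgrad δ M with hC₁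
  have hC₁0 : 0 ≤ C₁ := Cgrad_nonneg hδ hM0
  set N₂ : ℝ := (2 * (5 / 2) / δ + 1) ^ 3 with hN₂
  have hN₂0 : 0 ≤ N₂ := by positivity
  set v₀ : ℝ := (volume (ball (0 : E3) (rrb δ))).toReal with hv₀
  have hv₀pos : 0 < v₀ := ENNReal.toReal_pos (measure_ball_pos volume (0 : E3) (rrb_pos hδ)).ne' (measure_ball_lt_top).ne
  set V₅ : ℝ := (volume (closedBall (0 : E3) (5 / 2))).toReal with hV₅
  have hV₅0 : 0 ≤ V₅ := ENNReal.toReal_nonneg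
  set A : ℝ := C₁ ^ 3 * N₂ ^ 2 with hA
  have hA0 : 0 ≤ A := by positivity
  refine ⟨4 * A * V₅ * (1 + CL) / v₀, by positivity, 3, by norm_num, ?_⟩
  intro S hS R hR Ψ Q σ hd
  have hsep : IsSep δ S := hS.2.1
  have hσ0 : ∀ x, 0 ≤ σ x := hd.2.1
  have hR0 : 0 < R - 9 / 10 := by linarith
  -- the window as a Finset
  have hfin := finite_atomsIn hδ hsep R
  set W : Finset E3 := hfin.toFinset with hWdef
  have hW : ∀ x, x ∈ W ↔ x ∈ atomsIn (μS S) 0 R := fun x => hfin.mem_toFinset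
  have hWS : (↑W : Set E3) ⊆ S := fun x hx => (mem_atomsIn_iff.1 ((hW x).1 hx)).1
  have hWR : ∀ x ∈ W, ‖x‖ ≤ R := fun x hx => (mem_atomsIn_iff.1 ((hW x).1 hx)).2
  rw [finsum_mem_eq_finite_toFinset_sum _ hfin]
  -- the ball B₀, covering and weight
  set B0 : Set E3 := ball (0 : E3) (R - 9 / 10) with hB0
  have hcov : ∀ y ∈ B0, ∃ x ∈ W, dist y x < 9 / 10 := by
    intro y hy
    obtain ⟨x, hx, hxy⟩ := exists_atomsIn_dist_lt_of_doorP haHi hδ hS (by simpa [hB0] using hy)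
    exact ⟨x, (hW x).2 hx, hxy⟩
  have hD1 : ∀ y ∈ B0, 1 ≤ Dsum W y := by
    intro y hy
    obtain ⟨x, hx, hxy⟩ := hcov y hy
    exact one_le_Dsum hx (by linarith)
  -- the interpolant and its derivative on B₀
  set u : E3 → E3 := interp W Ψ Q with hu
  have hfd : ∀ y ∈ B0, ∀ x₀ : E3, fderiv ℝ u y = interpDeriv W Ψ Q x₀ y := fun y hy x₀ =>
    fderiv_interp_eq x₀ (by linarith [hD1 y hy] : Dsum W y ≠ 0)
  set Sσ : ℝ := ∑ x ∈ W, σ x with hSσ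
  have hSσ0 : 0 ≤ Sσ := Finset.sum_nonneg fun x _ => hσ0 x
  set K : ℝ := 1 + C₁ * Sσ with hK
  have hK0 : 0 ≤ K := by positivity
  have hnormfd : ∀ y ∈ B0, ‖fderiv ℝ u y‖ ≤ K := by
    intro y hy
    obtain ⟨x, hx, hxy⟩ := hcov y hy
    rw [hfd y hy x]
    exact norm_interpDeriv_le hδ hS haHi hd hM0 hM W hW hx (by linarith) (hD1 y hy)
  -- pointwise: dist(∇u, SO(3))³ ≤ A · g
  have hloc : ∀ y ∈ B0, ∀ x₀ ∈ W, dist y x₀ ≤ 6 / 5 → ‖fderiv ℝ u y - rotL Q x₀‖ ^ 3 ≤ A * gmaj W σ y := by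
    intro y hy x₀ hx₀ hyx₀
    rw [hfd y hy x₀]
    have h1 := norm_interpDeriv_sub_rotL_le hδ hS haHi hd hM0 hM W hW hx₀ hyx₀ (hD1 y hy)
    have h2 := sum_filter_pow_three_le hδ hsep W hWS y (by norm_num : (0 : ℝ) ≤ 5 / 2) hσ0
    have hs0 : 0 ≤ ∑ x ∈ W.filter (fun x => dist x y ≤ 5 / 2), σ x := Finset.sum_nonneg fun x _ => hσ0 x
    rw [gmaj_eq_sum_filter, hA]
    calc ‖interpDeriv W Ψ Q x₀ y - rotL Q x₀‖ ^ 3 ≤ (C₁ * ∑ x ∈ W.filter (fun x => dist x y ≤ 5 / 2), σ x) ^ 3 :=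
          pow_le_pow_left₀ (norm_nonneg _) h1 3
      _ = C₁ ^ 3 * (∑ x ∈ W.filter (fun x => dist x y ≤ 5 / 2), σ x) ^ 3 := by ring
      _ ≤ C₁ ^ 3 * (N₂ ^ 2 * ∑ x ∈ W.filter (fun x => dist x y ≤ 5 / 2), σ x ^ 3) := by
          refine mul_le_mul_of_nonneg_left ?_ (pow_nonneg hC₁0 3)
          rw [hN₂, ← pow_mul]
          rw [← pow_mul] at h2
          exact h2
      _ = C₁ ^ 3 * N₂ ^ 2 * ∑ x ∈ W.filter (fun x => dist x y ≤ 5 / 2), σ x ^ 3 := by ring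
  have hinf : ∀ y ∈ B0, infDist (fderiv ℝ u y) (rotations 3) ^ 3 ≤ A * gmaj W σ y := by
    intro y hy
    obtain ⟨x, hx, hxy⟩ := hcov y hy
    have h1 : infDist (fderiv ℝ u y) (rotations 3) ≤ ‖fderiv ℝ u y - rotL Q x‖ := by
      rw [← dist_eq_norm]; exact infDist_le_dist_of_mem (rotL_mem_rotations hd x)
    exact (pow_le_pow_left₀ infDist_nonneg h1 3).trans (hloc y hy x hx (by linarith))
  -- Lipschitz on B₀ and the fact
  have hLip : LipschitzOnWith (Real.toNNReal K) u B0 := by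
    refine (convex_ball (0 : E3) (R - 9 / 10)).lipschitzOnWith_of_nnnorm_fderiv_le (𝕜 := ℝ) (fun y hy => ?_) (fun y hy => ?_)
    · exact differentiableAt_interp (by linarith [hD1 y hy] : Dsum W y ≠ 0)
    · rw [← NNReal.coe_le_coe, coe_nnnorm, Real.coe_toNNReal K hK0]
      exact hnormfd y hy
  obtain ⟨Rot, hRot, hineq⟩ := hCL 0 (R - 9 / 10) hR0 u (Real.toNNReal K) hLip
  have h3 : ∀ t : ℝ, t ^ (3 : ℝ) = t ^ (3 : ℕ) := fun t => by
    rw [show (3 : ℝ) = ((3 : ℕ) : ℝ) by norm_num, Real.rpow_natCast]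
  simp only [h3] at hineq
  refine ⟨Rot, ?_⟩
  rw [finsum_mem_eq_finite_toFinset_sum _ hfin]
  -- integrability on B₀
  have hB0m : MeasurableSet B0 := measurableSet_ball
  have hB0fin : volume B0 < ⊤ := measure_ball_lt_top
  have hmeas_fd : Measurable (fderiv ℝ u) := measurable_fderiv ℝ u
  have hF1meas : Measurable fun y => ‖fderiv ℝ u y - Rot‖ ^ 3 :=
    ((continuous_norm.comp (continuous_id.sub continuous_const)).pow 3).measurable.comp hmeas_fd
  have hF2meas : Measurable fun y => infDist (fderiv ℝ u y) (rotations 3) ^ 3 :=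
    ((continuous_infDist_pt (rotations 3)).pow 3).measurable.comp hmeas_fd
  have hF1int : IntegrableOn (fun y => ‖fderiv ℝ u y - Rot‖ ^ 3) B0 := by
    refine IntegrableOn.of_bound hB0fin hF1meas.aestronglyMeasurable ((K + ‖Rot‖) ^ 3) ?_
    refine (ae_restrict_iff' hB0m).2 (Eventually.of_forall fun y hy => ?_)
    rw [Real.norm_of_nonneg (pow_nonneg (norm_nonneg _) 3)]
    exact pow_le_pow_left₀ (norm_nonneg _) ((norm_sub_le _ _).trans (add_le_add (hnormfd y hy) le_rfl)) 3
  have hGint : IntegrableOn (gmaj W σ) B0 := integrable_gmaj.integrableOn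
  have hF2int : IntegrableOn (fun y => infDist (fderiv ℝ u y) (rotations 3) ^ 3) B0 := by
    refine IntegrableOn.of_bound hB0fin hF2meas.aestronglyMeasurable (A * ∑ x ∈ W, σ x ^ 3) ?_
    refine (ae_restrict_iff' hB0m).2 (Eventually.of_forall fun y hy => ?_)
    rw [Real.norm_of_nonneg (pow_nonneg infDist_nonneg 3)]
    exact (hinf y hy).trans (mul_le_mul_of_nonneg_left (gmaj_le_sum hσ0 y) hA0)
  -- the integrand of the read-back
  set h : E3 → ℝ := fun y => 4 * (A * gmaj W σ y + ‖fderiv ℝ u y - Rot‖ ^ 3) with hh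
  have hh0 : ∀ y, 0 ≤ h y := fun y => by
    have := gmaj_nonneg (W := W) hσ0 y
    positivity
  have hhint : IntegrableOn h B0 := ((hGint.const_mul A).add hF1int).const_mul 4
  -- (1) per ball
  have hball : ∀ x₀ ∈ W, v₀ * ‖rotL Q x₀ - Rot‖ ^ 3 ≤ ∫ y in ball (kap R • x₀) (rrb δ), h y := by
    intro x₀ hx₀
    have hsub : ball (kap R • x₀) (rrb δ) ⊆ B0 := fun y hy => mem_ball_zero_iff.2 (readBack_mem hR (hWR x₀ hx₀) hy).1
    have hconst : ∫ y in ball (kap R • x₀) (rrb δ), ‖rotL Q x₀ - Rot‖ ^ 3 = v₀ * ‖rotL Q x₀ - Rot‖ ^ 3 := by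
      rw [setIntegral_const, smul_eq_mul, measureReal_def, volume_readBack]
    rw [← hconst]
    refine setIntegral_mono_on (integrableOn_const (measure_ball_lt_top).ne) (hhint.mono_set hsub) measurableSet_ball fun y hy => ?_
    have hyB : y ∈ B0 := hsub hy
    have hyx₀ : dist y x₀ ≤ 6 / 5 := (readBack_mem hR (hWR x₀ hx₀) hy).2
    have ha := hloc y hyB x₀ hx₀ hyx₀
    have hsplit : ‖rotL Q x₀ - Rot‖ ≤ ‖fderiv ℝ u y - rotL Q x₀‖ + ‖fderiv ℝ u y - Rot‖ := by
      rw [norm_sub_rev (fderiv ℝ u y) (rotL Q x₀)]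
      exact norm_sub_le_norm_sub_add_norm_sub _ _ _
    calc ‖rotL Q x₀ - Rot‖ ^ 3 ≤ (‖fderiv ℝ u y - rotL Q x₀‖ + ‖fderiv ℝ u y - Rot‖) ^ 3 :=
          pow_le_pow_left₀ (norm_nonneg _) hsplit 3
      _ ≤ 4 * (‖fderiv ℝ u y - rotL Q x₀‖ ^ 3 + ‖fderiv ℝ u y - Rot‖ ^ 3) :=
          add_pow_three_le_four _ _ (norm_nonneg _) (norm_nonneg _)
      _ ≤ h y := by rw [hh]; nlinarith
  -- (2) sum over the window = integral over the disjoint union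
  have hU : ∑ x₀ ∈ W, ∫ y in ball (kap R • x₀) (rrb δ), h y = ∫ y in ⋃ x₀ ∈ W, ball (kap R • x₀) (rrb δ), h y := by
    rw [integral_biUnion_finset W (fun _ _ => measurableSet_ball)
      (fun x₀ hx₀ x₁ hx₁ hne => readBack_disjoint hδ hR (hsep x₀ (hWS hx₀) x₁ (hWS hx₁) hne))]
    intro x₀ hx₀
    exact hhint.mono_set fun y hy => mem_ball_zero_iff.2 (readBack_mem hR (hWR x₀ hx₀) hy).1
  have hUsub : (⋃ x₀ ∈ W, ball (kap R • x₀) (rrb δ)) ⊆ B0 := by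
    intro y hy
    obtain ⟨x₀, hx₀, hyx⟩ := Set.mem_iUnion₂.1 hy
    exact mem_ball_zero_iff.2 (readBack_mem hR (hWR x₀ hx₀) hyx).1
  have hle3 : ∫ y in ⋃ x₀ ∈ W, ball (kap R • x₀) (rrb δ), h y ≤ ∫ y in B0, h y :=
    setIntegral_mono_set hhint (Eventually.of_forall fun y => hh0 y) hUsub.eventuallyLE
  -- (3) evaluate ∫_{B₀} h
  have hI : ∫ y in B0, h y = 4 * (A * (∫ y in B0, gmaj W σ y) + ∫ y in B0, ‖fderiv ℝ u y - Rot‖ ^ 3) := by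
    rw [hh, integral_const_mul, integral_add (hGint.const_mul A) hF1int, integral_const_mul]
  have hG := setIntegral_gmaj_le (W := W) hσ0 B0
  have hF2le : (∫ y in B0, infDist (fderiv ℝ u y) (rotations 3) ^ 3) ≤ A * ∫ y in B0, gmaj W σ y := by
    rw [← integral_const_mul]
    exact setIntegral_mono_on hF2int (hGint.const_mul A) hB0m fun y hy => hinf y hy
  -- (4) assemble
  have hsum : v₀ * ∑ x₀ ∈ W, ‖rotL Q x₀ - Rot‖ ^ 3 ≤ 4 * A * V₅ * (1 + CL) * ∑ x ∈ W, σ x ^ 3 := by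
    have hS30 : 0 ≤ ∑ x ∈ W, σ x ^ 3 := Finset.sum_nonneg fun x _ => pow_nonneg (hσ0 x) 3
    calc v₀ * ∑ x₀ ∈ W, ‖rotL Q x₀ - Rot‖ ^ 3 = ∑ x₀ ∈ W, v₀ * ‖rotL Q x₀ - Rot‖ ^ 3 := Finset.mul_sum _ _ _
      _ ≤ ∑ x₀ ∈ W, ∫ y in ball (kap R • x₀) (rrb δ), h y := Finset.sum_le_sum hball
      _ ≤ ∫ y in B0, h y := hU ▸ hle3
      _ = 4 * (A * (∫ y in B0, gmaj W σ y) + ∫ y in B0, ‖fderiv ℝ u y - Rot‖ ^ 3) := hI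
      _ ≤ 4 * (A * (V₅ * ∑ x ∈ W, σ x ^ 3) + CL * (A * (V₅ * ∑ x ∈ W, σ x ^ 3))) := by
          have h1 : A * (∫ y in B0, gmaj W σ y) ≤ A * (V₅ * ∑ x ∈ W, σ x ^ 3) := mul_le_mul_of_nonneg_left hG hA0
          have h2 : (∫ y in B0, ‖fderiv ℝ u y - Rot‖ ^ 3) ≤ CL * (A * (V₅ * ∑ x ∈ W, σ x ^ 3)) :=
            hineq.trans (mul_le_mul_of_nonneg_left (hF2le.trans h1) hCL0)
          linarith
      _ = 4 * A * V₅ * (1 + CL) * ∑ x ∈ W, σ x ^ 3 := by ring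
  rw [div_mul_eq_mul_div, le_div_iff₀ hv₀pos]
  simpa [rotL, mul_comm] using hsum

/-- ★ the LINE column's (K)-side, closed modulo the named fact: `FJM-L^p ⇒ TiltRigidityP aHi Λ θ s` for `aHi ≤ 8/7` (via TV's proved seam
`tiltRigidityP_of_fieldRigidityP`). -/
theorem tiltRigidityP_of_geometricRigidityLp (hfact : FrieseckeJamesMuller2002_geometricRigidityLp) (haHi : aHi ≤ 8 / 7) (Λ θ s : ℝ) :
    TiltRigidityP aHi Λ θ s :=
  tiltRigidityP_of_fieldRigidityP (fieldRigidityP_of_geometricRigidityLp hfact haHi) haHi Λ θ s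

/-- ★ the LINE `_16XH19(_tol)` after g42/g43: `R_W ⟸ FJM-L^p ∧ (M)` — `WildFractionPG aHi Λ θ s` from the named fact and the strain
non-concentration piece `StrainNonConcentrationPG` alone (TR's proved seam `wildFractionPG_of_tilt_strain`). -/
theorem wildFractionPG_of_geometricRigidityLp_strain {Λ θ s : ℝ} (hfact : FrieseckeJamesMuller2002_geometricRigidityLp) (haHi : aHi ≤ 8 / 7)
    (hM : StrainNonConcentrationPG aHi Λ θ s) : WildFractionPG aHi Λ θ s :=
  wildFractionPG_of_tilt_strain (tiltRigidityP_of_geometricRigidityLp hfact haHi Λ θ s) hM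

end Main

end Summit.AtomisticToContinuum.Crystallization.Theorems.ChartedZeroExcessLayeredLatticeLiouville

end
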